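import Summits.ABC.ABC.Theses.DefiniteXi
import Literature.NumberTheory.EllipticCurves.OpenImageMazurAssemblyProofs
import Literature.NumberTheory.EllipticCurves.OpenImageMazurInertiaThreeProofs
import Literature.NumberTheory.EllipticCurves.CyclicIsogenyCharacterFrobeniusProofs
import Literature.NumberTheory.EllipticCurves.RationalIsogenyFrobeniusCriterionPrimePower
import Literature.NumberTheory.EllipticCurves.MultiplicativeInertiaLineProofs
import Literature.NumberTheory.EllipticCurves.OrdinaryReductionTorsionCharactersProofs
import Literature.NumberTheory.EllipticCurves.OrdinaryReductionUnramifiedCharacterProofs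
import Literature.NumberTheory.EllipticCurves.TateCurve.NumberFieldUniformizationTwisted
import HarnessLib

/-!
# Stub-ideation k=2 (gen 2, RESHAPE family) for `stub_pasten163` — crux `DefiniteRTControlPrime`

Companion to `STUB-IDEAS-stub_pasten163-2.md` (gen 2).  Scratch check that the helper-lemma
statements elaborate; every `sorry` below is a HELPER to be proved by the stub prover, nothing here
is claimed proved.

Plan A (verbatim stub) = import the shared item (`mazurKenkuBound_of_radiusItem`, k=1's
`stub_pasten163_of_radius`); nothing new to type.

Plan B (RESHAPE, uses the idle `C·N^ε` of the crux) = k=1's `FreyIsogenyDiameter`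
(`…Sketch.Ideas1.FreyIsogenyDiameter`).  This file is the FINE CUT of its one new input, k=1's
H5 `primePow_dvd_frobNorm_of_split` (level `ℓᵏ`: a SPLIT pair of `Γ_ℚ`-stable cyclic subgroups
of order `ℓᵏ` forces `ℓᵏ ∣ n₁₂(p) = p¹² + 1 − s₁₂(a_p, p)`), into one-cycle helpers:

* A1/A1′ — pure `ZMod` algebra: the resultant form of the Frobenius congruence
  (`n₁₂ = Res(X¹²−1, X²−aX+p)`, `n₄ = Res(X⁴−1, X²−aX+p) = ((p+1)²−a²)(a²+(p−1)²)`);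
* A2/A3 — pure finite-group algebra: a unipotent `(1 *; 0 1)` basis admits NO complementary stable
  cyclic pair unless `* = 0`; a Borel `(x *; 0 y)` basis with one `x − y` a unit forces the pair to be
  `{ℤP₁, L}` with the action on `L` by `y` (both brute-force checked over `ℤ/9, ℤ/25, ℤ/27`);
* L1 — global unipotent Tate basis of `E[ℓᵏ]` at a multiplicative `v ∤ ℓ` (transport of the tree's
  LOCAL `exists_tateBasis_localPoints_of_hasMultiplicativeReductionAt`), hence L1′: split ⇒ inertia
  at `v` fixes `E[ℓᵏ]`;
* L2 — Borel bases of `E[ℓᵏ]` at `v ∣ ℓ`: good ordinary (the tree's PROVED Greenberg facts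
  `ordinaryReduction_inertia_smul_of_mem_kernelReduction_holds`,
  `ordinaryReduction_exists_unramified_character_mod_kernelReduction_holds`) and multiplicative
  (the tree's PROVED twisted Tate uniformisation `Silverman1994_thmV53_corV54_tateUniformisation_holds`);
  L2c: no stable line at a supersingular `ℓ` (the `exfalso` branch of
  `Mazur1978.modEq_zero_or_one_of_hasGoodReductionAtPrime`, applied to `A[ℓ]`);
* L3 — at the place `2` (`ℓᵏ` odd): `r_A(τ)¹² = 1` (`pow_twelve_smul_eq_of_mem_inertia_of_valuation_j_le_one_of_three`
  if `v₂(j) ≥ 0`; twist to multiplicative + L1′ if `v₂(j) < 0`, giving `r_A(τ)² = 1`);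
* G1 — Minkowski (`monoidHom_eq_one_of_forall_inertia`): `r_A = b·χ_{ℓᵏ}^ε`, `b¹² = 1`, `ε ∈ {0,1}`;
* H5 — G1 + the tree's level-`ℓᵏ` Frobenius congruence
  `Mazur1978.cyclicCharacter_sq_sub_frobeniusTrace_mul_add_eq_zero` + `χ_{ℓᵏ}(Frob_p) = p`
  (`modNCyclotomicCharacter_eq_residueCard_of_isArithFrobAt`) + A1.

No Mazur 1978 Thm 1, no Kenku, no modular-curve rational points anywhere in the chain.
-/

namespace Summit.ABC.ABC.Cruxes.DefiniteRTControlPrime.Sketch.Ideas2g2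

open Literature.NumberTheory.EllipticCurves Literature.NumberTheory.GaloisRepresentations
open WeierstrassCurve IsDedekindDomain NumberField Field

/-! ## A — pure algebra (one cycle each) -/

/-- A1 (resultant form of Cor. 6.1 (2), level `n`): if `t` is a root of `X² − aX + p` in `ℤ/n`
of the shape `t = b·p^ε` with `b¹² = 1`, `ε ∈ {0,1}`, `p` a unit mod `n`, then
`n ∣ p¹² + 1 − s₁₂(a,p)`.  Proof: `α := t`, `β := p·t⁻¹`; `α+β = a`, `αβ = p`;
`Mazur1978.frobTracePow_spec` gives `s₁₂ = α¹² + β¹² = p^{12ε} + p^{12(1−ε)} = 1 + p¹²`;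
finish with `ZMod.intCast_zmod_eq_zero_iff_dvd`. -/
theorem natCast_dvd_frobNorm_of_root {n p : ℕ} [NeZero n] (a : ℤ) (hp : IsUnit (p : ZMod n))
    {t b : ZMod n} (hb : b ^ 12 = 1) {ε : ℕ} (hε : ε = 0 ∨ ε = 1)
    (ht : t = b * (p : ZMod n) ^ ε)
    (hroot : t ^ 2 - (a : ZMod n) * t + (p : ZMod n) = 0) :
    (n : ℤ) ∣ (p : ℤ) ^ 12 + 1 - Mazur1978.frobTracePow a p 12 := by
  sorry

/-- A1′ (the `n₄` sharpening, same proof with `s₄ = (a² − 2p)² − 2p²`):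
`b⁴ = 1 ⇒ n ∣ n₄(p) = ((p+1)² − a²)·(a² + (p−1)²)`, and `(p²−1)² ≤ n₄ ≤ (p²+1)²` by Hasse. -/
theorem natCast_dvd_frobNormFour_of_root {n p : ℕ} [NeZero n] (a : ℤ) (hp : IsUnit (p : ZMod n))
    {t b : ZMod n} (hb : b ^ 4 = 1) {ε : ℕ} (hε : ε = 0 ∨ ε = 1)
    (ht : t = b * (p : ZMod n) ^ ε)
    (hroot : t ^ 2 - (a : ZMod n) * t + (p : ZMod n) = 0) :
    (n : ℤ) ∣ (((p : ℤ) + 1) ^ 2 - a ^ 2) * (a ^ 2 + ((p : ℤ) - 1) ^ 2) := by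
  sorry

/-- A2 (unipotent basis admits no complementary stable cyclic pair unless trivial).  `M = E[ℓᵏ]`,
`(P₁,P₂)` a generating pair (a basis, by counting), `τ = (1 m; 0 1)`; if `A ⊕ B = M` with `A`, `B`
cyclic of order `ℓᵏ` and `τ`-stable then `τ = 1`.  (Write `A = ⟨αP₁+βP₂⟩`, `B = ⟨γP₁+δP₂⟩`;
`A ⊓ B = ⊥` forces `β` or `δ` to be a unit; if `β` is a unit, `τ`-stability of `A` gives
`(λ−1)β = 0`, `λ = 1`, `βm = 0`, `m = 0`.)  Brute-force checked for `ℓᵏ = 9, 25, 27`. -/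
theorem smul_eq_self_of_unipotentBasis_of_split {M : Type*} [AddCommGroup M] (ℓ k : ℕ)
    [Fact ℓ.Prime] (hk : 1 ≤ k) (hM : Nat.card M = ℓ ^ (2 * k)) {P₁ P₂ : M}
    (h₁ : ℓ ^ k • P₁ = 0) (h₂ : ℓ ^ k • P₂ = 0)
    (hgen : ∀ Q : M, ∃ a b : ℕ, Q = a • P₁ + b • P₂)
    (τ : M →+ M) (hτ₁ : τ P₁ = P₁) (hτ₂ : ∃ m : ℕ, τ P₂ - P₂ = m • P₁)
    (A B : AddSubgroup M) (hA : IsAddCyclic A) (hB : IsAddCyclic B) (hAn : Nat.card A = ℓ ^ k)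
    (hBn : Nat.card B = ℓ ^ k) (hAB : A ⊓ B = ⊥) (hAst : ∀ Q ∈ A, τ Q ∈ A)
    (hBst : ∀ Q ∈ B, τ Q ∈ B) : ∀ Q : M, τ Q = Q := by
  sorry

/-- A3 (Borel basis: the split pair is `{ℤP₁, L}` and the action on `L` is by the quotient
scalar).  `M = E[ℓᵏ]`, `(P₁,P₂)` generating, a family `τ i` acting by `τ i P₁ = x i • P₁` and
`τ i Q − y i • Q ∈ ℤP₁`; if some `x i₀ − y i₀` is prime to `ℓ`, a complementary stable cyclic pair
`A ⊕ B` of order `ℓᵏ` has one member equal to `ℤP₁` and every `τ i` acts on the other by `y i`.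
(Coordinates as in A2: both `β, δ` units would force `(x−y)(αδ−βγ) ≡ 0`; so, say, `δ ∉ (ℤ/ℓᵏ)ˣ`,
then `β, γ` are units, `λ_A = y`, and at `i₀` the relation `(x−y)(βγ−αδ)(βγ)⁻¹ δ = 0` gives
`δ = 0`.)  Brute-force checked for `ℓᵏ = 3, 7, 9, 25, 27`. -/
theorem eq_zmultiples_of_borelBasis_of_split {M : Type*} [AddCommGroup M] (ℓ k : ℕ)
    [Fact ℓ.Prime] (hk : 1 ≤ k) (hM : Nat.card M = ℓ ^ (2 * k)) {P₁ P₂ : M}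
    (h₁ : ℓ ^ k • P₁ = 0) (h₂ : ℓ ^ k • P₂ = 0)
    (hgen : ∀ Q : M, ∃ a b : ℕ, Q = a • P₁ + b • P₂)
    {ι : Type*} (τ : ι → (M →+ M)) (x y : ι → ℤ) (hx : ∀ i, τ i P₁ = x i • P₁)
    (hy : ∀ i (Q : M), τ i Q - y i • Q ∈ AddSubgroup.zmultiples P₁)
    (i₀ : ι) (hi₀ : IsUnit ((x i₀ - y i₀ : ℤ) : ZMod ℓ))
    (A B : AddSubgroup M) (hA : IsAddCyclic A) (hB : IsAddCyclic B) (hAn : Nat.card A = ℓ ^ k)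
    (hBn : Nat.card B = ℓ ^ k) (hAB : A ⊓ B = ⊥) (hAst : ∀ i, ∀ Q ∈ A, τ i Q ∈ A)
    (hBst : ∀ i, ∀ Q ∈ B, τ i Q ∈ B) :
    (B = AddSubgroup.zmultiples P₁ ∧ ∀ i, ∀ Q ∈ A, τ i Q = y i • Q) ∨
      (A = AddSubgroup.zmultiples P₁ ∧ ∀ i, ∀ Q ∈ B, τ i Q = y i • Q) := by
  sorry

/-! ## G0 — glue from k=1's binders (`A` cyclic of order `ℓᵏ`, stable) to a point + character -/

/-- G0: a stable cyclic subgroup of order `ℓᵏ` is `ℤP` for a point of exact order `ℓᵏ` with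
`σP ∈ ℤP`; then `RationalIsogenyFrobeniusCriterionPrimePower.exists_cyclicCharacter_of_addOrderOf`
gives the character `r : Γ_ℚ →* (ℤ/ℓᵏ)ˣ`. -/
theorem exists_generator_of_stable_cyclic {W : WeierstrassCurve ℚ} (ℓ k : ℕ) [Fact ℓ.Prime]
    (A : AddSubgroup (geomPoints W)) (hAc : IsAddCyclic A) (hAcard : Nat.card A = ℓ ^ k)
    (hAst : ∀ σ : absoluteGaloisGroup ℚ, ∀ Q ∈ A, σ • Q ∈ A) :
    ∃ P : geomPoints W, AddSubgroup.zmultiples P = A ∧ addOrderOf P = ℓ ^ k ∧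
      ∀ σ : absoluteGaloisGroup ℚ, σ • P ∈ AddSubgroup.zmultiples P := by
  sorry

/-! ## L — local shapes at level `ℓᵏ`, transported to `Γ_ℚ`-inertia groups -/

/-- L1 (global unipotent Tate basis at a multiplicative `v ∤ ℓ`): transport of the tree's LOCAL
`WeierstrassCurve.exists_tateBasis_localPoints_of_hasMultiplicativeReductionAt` along
`E(ℚ̄) ↪ E(ℚ̄_v)` (pattern: `smul_smul_sub_eq_of_mem_inertia_geomPoints`, Neukirch II (9.6)
`exists_mem_inertia_apply_eq_holds` / `exists_smul_eq_of_mem_primesAbove_holds`). -/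
theorem exists_unipotentBasis_of_hasMultiplicativeReductionAt (W : WeierstrassCurve ℚ)
    [W.IsElliptic] {v : HeightOneSpectrum (𝓞 ℚ)} (hv : W.HasMultiplicativeReductionAt v)
    {ℓ : ℕ} (hℓ : ℓ.Prime) (hℓv : (ℓ : 𝓞 ℚ) ∉ v.asIdeal) {k : ℕ} (hk : 1 ≤ k)
    {𝔓 : Ideal (absIntegers (𝓞 ℚ) ℚ)} (h𝔓 : 𝔓 ∈ v.primesAbove) :
    ∃ P₁ P₂ : geomPoints W, ℓ ^ k • P₁ = 0 ∧ ℓ ^ k • P₂ = 0 ∧ ℓ ^ (k - 1) • P₁ ≠ 0 ∧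
      (∀ Q : geomPoints W, ℓ ^ k • Q = 0 → ∃ a b : ℕ, Q = a • P₁ + b • P₂) ∧
      ∀ τ ∈ 𝔓.inertia (absoluteGaloisGroup ℚ),
        τ • P₁ = P₁ ∧ ∃ m : ℕ, τ • P₂ - P₂ = m • P₁ := by
  sorry

/-- L1′ (split ⇒ unramified at a multiplicative `v ∤ ℓ`): L1 + A2 on `M = E[ℓᵏ]`
(`#E[ℓᵏ] = ℓ^{2k}`: `card_torsionPoints_eq_sq_holds`).  For the Frey class: every odd `v ≠ ℓ`
of bad reduction. -/
theorem smul_eq_of_mem_inertia_of_split (W : WeierstrassCurve ℚ) [W.IsElliptic]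
    {v : HeightOneSpectrum (𝓞 ℚ)} (hv : W.HasMultiplicativeReductionAt v) (ℓ k : ℕ)
    [Fact ℓ.Prime] (hℓv : (ℓ : 𝓞 ℚ) ∉ v.asIdeal) (hk : 1 ≤ k)
    (A B : AddSubgroup (geomPoints W)) (hA : A ≤ geomTorsion W ((ℓ : ℤ) ^ k))
    (hB : B ≤ geomTorsion W ((ℓ : ℤ) ^ k)) (hAc : IsAddCyclic A) (hBc : IsAddCyclic B)
    (hAcard : Nat.card A = ℓ ^ k) (hBcard : Nat.card B = ℓ ^ k) (hAB : A ⊓ B = ⊥)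
    (hAst : ∀ σ : absoluteGaloisGroup ℚ, ∀ Q ∈ A, σ • Q ∈ A)
    (hBst : ∀ σ : absoluteGaloisGroup ℚ, ∀ Q ∈ B, σ • Q ∈ B)
    {𝔓 : Ideal (absIntegers (𝓞 ℚ) ℚ)} (h𝔓 : 𝔓 ∈ v.primesAbove)
    {τ : absoluteGaloisGroup ℚ} (hτ : τ ∈ 𝔓.inertia (absoluteGaloisGroup ℚ))
    {Q : geomPoints W} (hQ : ℓ ^ k • Q = 0) : τ • Q = Q := by
  sorry

/-- L2a (Borel basis at a good ORDINARY `v ∣ ℓ`, level `ℓᵏ`): `P₁` generates `C_v[ℓᵏ]` (the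
`ℓᵏ`-torsion in the kernel of reduction, cyclic of order `ℓᵏ`: `TateModule.card_ker_torsionBy_pow`
/ `exists_mem_ker_map_proj_eq`); inertia acts on it through `χ_{ℓᵏ}`
(`ordinaryReduction_inertia_smul_of_mem_kernelReduction_holds`) and trivially modulo it
(`ordinaryReduction_exists_unramified_character_mod_kernelReduction_holds`, `φ = 1` on inertia);
sub-helper: `toZModPow k ∘ cyclotomicCharacter (K_v) ℓ ∘ res = modNCyclotomicCharacter ℚ (ℓᵏ)` on
`I_𝔓` (cf. `cyclotomicCharacter_absGaloisRestrict`). -/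
theorem exists_borelBasis_of_ordinary (W : WeierstrassCurve ℚ) [W.IsElliptic]
    {v : HeightOneSpectrum (𝓞 ℚ)} (hgood : W.HasGoodReductionAt v) (ℓ k : ℕ) [Fact ℓ.Prime]
    (hℓv : (ℓ : 𝓞 ℚ) ∈ v.asIdeal) (hord : ¬ ((ℓ : ℤ) ∣ W.frobeniusTraceAt v)) (hk : 1 ≤ k)
    {𝔓 : Ideal (absIntegers (𝓞 ℚ) ℚ)} (h𝔓 : 𝔓 ∈ v.primesAbove) :
    ∃ P₁ P₂ : geomPoints W, ℓ ^ k • P₁ = 0 ∧ ℓ ^ k • P₂ = 0 ∧ ℓ ^ (k - 1) • P₁ ≠ 0 ∧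
      (∀ Q : geomPoints W, ℓ ^ k • Q = 0 → ∃ a b : ℕ, Q = a • P₁ + b • P₂) ∧
      ∀ τ ∈ 𝔓.inertia (absoluteGaloisGroup ℚ),
        τ • P₁ = ((((modNCyclotomicCharacter ℚ (ℓ ^ k) τ : (ZMod (ℓ ^ k))ˣ) :
          ZMod (ℓ ^ k)).val : ℤ)) • P₁ ∧
        ∀ Q : geomPoints W, ℓ ^ k • Q = 0 → τ • Q - Q ∈ AddSubgroup.zmultiples P₁ := by
  sorry

/-- L2b (twisted Borel basis at a MULTIPLICATIVE `v ∣ ℓ`, `ℓ` odd, level `ℓᵏ`): from the PROVED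
twisted Tate uniformisation `Silverman1994_thmV53_corV54_tateUniformisation_holds`
(`Ψ : K̄_vˣ → E(K̄_v)`, kernel `q^ℤ`, `σΨ(u) = ±Ψ(σu)`): `P₁ = Ψ(ζ_{ℓᵏ})`, `P₂ = Ψ(q^{1/ℓᵏ})`;
for `τ ∈ I_𝔓` with sign `s(τ) = ±1`: `τP₁ = s·χ_{ℓᵏ}(τ)P₁`, `τQ − sQ ∈ ℤP₁` (Kummer theory of
`q^{1/ℓᵏ}`), transported to `E(ℚ̄)` as in L1.  (That `s = 1` on inertia — `ℚ_v(√γ)` unramified in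
the non-split case — is NOT needed downstream.)  HARDEST helper of the cut. -/
theorem exists_twistedBorelBasis_of_hasMultiplicativeReductionAt (W : WeierstrassCurve ℚ)
    [W.IsElliptic] {v : HeightOneSpectrum (𝓞 ℚ)} (hv : W.HasMultiplicativeReductionAt v)
    (ℓ k : ℕ) [Fact ℓ.Prime] (hℓ2 : ℓ ≠ 2) (hℓv : (ℓ : 𝓞 ℚ) ∈ v.asIdeal) (hk : 1 ≤ k)
    {𝔓 : Ideal (absIntegers (𝓞 ℚ) ℚ)} (h𝔓 : 𝔓 ∈ v.primesAbove) :
    ∃ P₁ P₂ : geomPoints W, ℓ ^ k • P₁ = 0 ∧ ℓ ^ k • P₂ = 0 ∧ ℓ ^ (k - 1) • P₁ ≠ 0 ∧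
      (∀ Q : geomPoints W, ℓ ^ k • Q = 0 → ∃ a b : ℕ, Q = a • P₁ + b • P₂) ∧
      ∀ τ ∈ 𝔓.inertia (absoluteGaloisGroup ℚ), ∃ s : ℤ, (s = 1 ∨ s = -1) ∧
        τ • P₁ = (s * ((((modNCyclotomicCharacter ℚ (ℓ ^ k) τ : (ZMod (ℓ ^ k))ˣ) :
          ZMod (ℓ ^ k)).val : ℤ))) • P₁ ∧
        ∀ Q : geomPoints W, ℓ ^ k • Q = 0 → τ • Q - s • Q ∈ AddSubgroup.zmultiples P₁ := by
  sorry

/-- L2c (no stable line at a supersingular `ℓ ≥ 3`; applied to `A[ℓ] = ℓ^{k−1}A`): verbatim the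
`exfalso` branch of `Mazur1978.modEq_zero_or_one_of_hasGoodReductionAtPrime`
(`isCyclic_and_card_inertia_map_of_dvd_frobeniusTrace`, `pow_smul_eq_self_of_sub_mem_zmultiples`,
`N² − 1 ∤ N(N−1)`). -/
theorem not_dvd_frobeniusTrace_of_stableLine (W : WeierstrassCurve ℚ) [W.IsElliptic]
    [W.IsGloballyMinimal] (ℓ : ℕ) [Fact ℓ.Prime] (hℓ3 : 3 ≤ ℓ) (hgood : W.HasGoodReductionAtPrime ℓ)
    {P : geomTorsion W ℓ} (hP0 : P ≠ 0)
    (hst : ∀ σ : absoluteGaloisGroup ℚ, σ • P ∈ AddSubgroup.zmultiples P) :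
    ¬ ((ℓ : ℤ) ∣ W.frobeniusTrace ℓ) := by
  sorry

/-- L2 (the character of one member of a split pair at `ℓ`, `W` semistable at `ℓ`): there is
`ε ∈ {0,1}` with `(r_A(τ)·χ_{ℓᵏ}(τ)^{-ε})² = 1` for every `τ` in an inertia group at `ℓ`
(`= 1` in the good ordinary case).  Assembly of L2a/L2b/L2c with A3, using an inertia element
`τ₀` with `χ_{ℓᵏ}(τ₀) ≢ 1 (mod ℓ)` (`exists_mem_inertia_modNCyclotomicCharacter_eq`, `ℓ ≥ 3`). -/
theorem exists_cyclicCharacter_sq_eq_at_ell (W : WeierstrassCurve ℚ) [W.IsElliptic]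
    [W.IsGloballyMinimal] (ℓ k : ℕ) [Fact ℓ.Prime] (hℓ2 : ℓ ≠ 2) (hk : 1 ≤ k)
    {v : HeightOneSpectrum (𝓞 ℚ)} (hℓv : (ℓ : 𝓞 ℚ) ∈ v.asIdeal) (hss : W.IsSemistableAt v)
    (A B : AddSubgroup (geomPoints W)) (hA : A ≤ geomTorsion W ((ℓ : ℤ) ^ k))
    (hB : B ≤ geomTorsion W ((ℓ : ℤ) ^ k)) (hAc : IsAddCyclic A) (hBc : IsAddCyclic B)
    (hAcard : Nat.card A = ℓ ^ k) (hBcard : Nat.card B = ℓ ^ k) (hAB : A ⊓ B = ⊥)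
    (hAst : ∀ σ : absoluteGaloisGroup ℚ, ∀ Q ∈ A, σ • Q ∈ A)
    (hBst : ∀ σ : absoluteGaloisGroup ℚ, ∀ Q ∈ B, σ • Q ∈ B)
    {P : geomPoints W} (hPA : AddSubgroup.zmultiples P = A) (hP : addOrderOf P = ℓ ^ k)
    {r : absoluteGaloisGroup ℚ →* (ZMod (ℓ ^ k))ˣ}
    (hr : ∀ σ : absoluteGaloisGroup ℚ, σ • P = ((r σ : (ZMod (ℓ ^ k))ˣ) : ZMod (ℓ ^ k)).val • P) :
    ∃ ε : ℕ, (ε = 0 ∨ ε = 1) ∧ ∀ 𝔓 ∈ v.primesAbove, ∀ τ ∈ 𝔓.inertia (absoluteGaloisGroup ℚ),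
      (r τ * (modNCyclotomicCharacter ℚ (ℓ ^ k) τ ^ ε)⁻¹) ^ 2 = 1 := by
  sorry

/-- L3 (the place `2`, `ℓᵏ` odd): `r_A(τ)¹² = 1` on inertia at `2`.  Cases on `v₂(j)`:
`v₂(j) ≥ 0` — `Mazur1978.pow_twelve_smul_eq_of_mem_inertia_of_valuation_j_le_one_of_three`
(`3 ∉ v`, `ℓᵏ ∉ v`) and `eq_one_of_val_smul_eq_of_addOrderOf`; `v₂(j) < 0` — a quadratic twist
`W^{(d)}` is multiplicative at `2`
(`exists_hasMultiplicativeReductionAt_quadraticTwist_of_one_lt_valuation_j`), the signed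
equivalence `exists_addEquiv_geomPoints_quadraticTwist_signed` carries the split pair over, and L1′
there gives `τ = ±1` on `E[ℓᵏ]`, so `r_A(τ)² = 1`.  (Good reduction at `2`:
`cyclicCharacter_eq_one_of_mem_inertia`.) -/
theorem cyclicCharacter_pow_twelve_eq_one_at_two (W : WeierstrassCurve ℚ) [W.IsElliptic]
    (ℓ k : ℕ) [Fact ℓ.Prime] (hℓ2 : ℓ ≠ 2) (hk : 1 ≤ k)
    (A B : AddSubgroup (geomPoints W)) (hA : A ≤ geomTorsion W ((ℓ : ℤ) ^ k))
    (hB : B ≤ geomTorsion W ((ℓ : ℤ) ^ k)) (hAc : IsAddCyclic A) (hBc : IsAddCyclic B)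
    (hAcard : Nat.card A = ℓ ^ k) (hBcard : Nat.card B = ℓ ^ k) (hAB : A ⊓ B = ⊥)
    (hAst : ∀ σ : absoluteGaloisGroup ℚ, ∀ Q ∈ A, σ • Q ∈ A)
    (hBst : ∀ σ : absoluteGaloisGroup ℚ, ∀ Q ∈ B, σ • Q ∈ B)
    {P : geomPoints W} (hPA : AddSubgroup.zmultiples P = A) (hP : addOrderOf P = ℓ ^ k)
    {r : absoluteGaloisGroup ℚ →* (ZMod (ℓ ^ k))ˣ}
    (hr : ∀ σ : absoluteGaloisGroup ℚ, σ • P = ((r σ : (ZMod (ℓ ^ k))ˣ) : ZMod (ℓ ^ k)).val • P)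
    {v : HeightOneSpectrum (𝓞 ℚ)} (h2v : (2 : 𝓞 ℚ) ∈ v.asIdeal)
    {𝔓 : Ideal (absIntegers (𝓞 ℚ) ℚ)} (h𝔓 : 𝔓 ∈ v.primesAbove)
    {τ : absoluteGaloisGroup ℚ} (hτ : τ ∈ 𝔓.inertia (absoluteGaloisGroup ℚ)) :
    r τ ^ 12 = 1 := by
  sorry

/-! ## G1 — Minkowski: the normal form `r_A = b·χ^ε`, `b¹² = 1` (Mazur-free at level `ℓᵏ`) -/

/-- G1: for a curve semistable away from `2`, the character of one member of a split pair of
order `ℓᵏ` (`ℓ` odd) is `b·χ_{ℓᵏ}^ε` with `b¹² = 1`, `ε ∈ {0,1}`.  `ψ := (r·χ^{-ε})¹²` is trivial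
on every inertia group (L1′ at odd multiplicative `v ≠ ℓ`; L2 at `ℓ`; L3 at `2`;
`cyclicCharacter_eq_one_of_mem_inertia` + `modNCyclotomicCharacter_eq_one_of_mem_inertia` at good
`v ∤ 2ℓ`), has open kernel, hence `ψ = 1` by `monoidHom_eq_one_of_forall_inertia`. -/
theorem exists_cyclicCharacter_eq_mul_pow (W : WeierstrassCurve ℚ) [W.IsElliptic]
    [W.IsGloballyMinimal] (ℓ k : ℕ) [Fact ℓ.Prime] (hℓ2 : ℓ ≠ 2) (hk : 1 ≤ k)
    (hss : ∀ v : HeightOneSpectrum (𝓞 ℚ), (2 : 𝓞 ℚ) ∉ v.asIdeal → W.IsSemistableAt v)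
    (A B : AddSubgroup (geomPoints W)) (hA : A ≤ geomTorsion W ((ℓ : ℤ) ^ k))
    (hB : B ≤ geomTorsion W ((ℓ : ℤ) ^ k)) (hAc : IsAddCyclic A) (hBc : IsAddCyclic B)
    (hAcard : Nat.card A = ℓ ^ k) (hBcard : Nat.card B = ℓ ^ k) (hAB : A ⊓ B = ⊥)
    (hAst : ∀ σ : absoluteGaloisGroup ℚ, ∀ Q ∈ A, σ • Q ∈ A)
    (hBst : ∀ σ : absoluteGaloisGroup ℚ, ∀ Q ∈ B, σ • Q ∈ B)
    {P : geomPoints W} (hPA : AddSubgroup.zmultiples P = A) (hP : addOrderOf P = ℓ ^ k)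
    {r : absoluteGaloisGroup ℚ →* (ZMod (ℓ ^ k))ˣ}
    (hr : ∀ σ : absoluteGaloisGroup ℚ, σ • P = ((r σ : (ZMod (ℓ ^ k))ˣ) : ZMod (ℓ ^ k)).val • P) :
    ∃ ε : ℕ, (ε = 0 ∨ ε = 1) ∧ ∀ σ : absoluteGaloisGroup ℚ,
      (r σ * (modNCyclotomicCharacter ℚ (ℓ ^ k) σ ^ ε)⁻¹) ^ 12 = 1 := by
  sorry

/-! ## H5 — k=1's `primePow_dvd_frobNorm_of_split`, from G1 + tree Frobenius + A1 -/

/-- H5 (verbatim the statement of k=1's `…Sketch.Ideas1.primePow_dvd_frobNorm_of_split`): G0 gives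
`P, r`; G1 gives `r = b·χ^ε`; at an arithmetic Frobenius `φ` above the good prime `p ∤ 2ℓ`
(`primesAbove_nonempty`, `exists_isArithFrobAt_of_mem_primesAbove_holds`) the tree's
`Mazur1978.cyclicCharacter_sq_sub_frobeniusTrace_mul_add_eq_zero` gives `t := r(φ)` a root of
`X² − a_pX + p` mod `ℓᵏ`, `modNCyclotomicCharacter_eq_residueCard_of_isArithFrobAt` gives
`χ_{ℓᵏ}(φ) = p`, so `t = b·p^ε` with `b¹² = 1`; A1 concludes (`p` is a unit mod `ℓᵏ` as `p ≠ ℓ`). -/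
theorem primePow_dvd_frobNorm_of_split (W₁ : WeierstrassCurve ℚ) [W₁.IsElliptic]
    [W₁.IsGloballyMinimal] (ℓ k : ℕ) [Fact ℓ.Prime] (hℓ2 : ℓ ≠ 2)
    (hss : ∀ v : HeightOneSpectrum (𝓞 ℚ), (2 : 𝓞 ℚ) ∉ v.asIdeal → W₁.IsSemistableAt v)
    (A B : AddSubgroup (geomPoints W₁)) (hA : A ≤ geomTorsion W₁ ((ℓ : ℤ) ^ k))
    (hB : B ≤ geomTorsion W₁ ((ℓ : ℤ) ^ k)) (hAc : IsAddCyclic A) (hBc : IsAddCyclic B)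
    (hAcard : Nat.card A = ℓ ^ k) (hBcard : Nat.card B = ℓ ^ k) (hAB : A ⊓ B = ⊥)
    (hAst : ∀ σ : Field.absoluteGaloisGroup ℚ, ∀ Q : geomPoints W₁, Q ∈ A → σ • Q ∈ A)
    (hBst : ∀ σ : Field.absoluteGaloisGroup ℚ, ∀ Q : geomPoints W₁, Q ∈ B → σ • Q ∈ B)
    (p : ℕ) [Fact p.Prime] (hp2 : p ≠ 2) (hpℓ : p ≠ ℓ) (hgood : W₁.HasGoodReductionAtPrime p) :
    ((ℓ : ℤ) ^ k) ∣ (p : ℤ) ^ 12 + 1 - Mazur1978.frobTracePow (W₁.frobeniusTrace p) p 12 := by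
  sorry

end Summit.ABC.ABC.Cruxes.DefiniteRTControlPrime.Sketch.Ideas2g2
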